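import Literature.NumberTheory.Automorphic.UnitaryDualPairDoubledLineStabiliser
import Literature.NumberTheory.Automorphic.UnitaryGroupDirectSumCarriers
import Literature.NumberTheory.Automorphic.UnitaryGroupDoubledSiegelBruhat
import Literature.NumberTheory.Automorphic.UnitaryGroupSplitPlace
import HarnessLib

/-!
# `U(1,1)(F)`: a homomorphism to a commutative group that kills the rational Siegel parabolic `P_Δ(F)` is trivial

Topic `NumberTheory/Automorphic`; namespace `Literature.NumberTheory.Automorphic.UnitaryGroup` (sequel of ★ `UnitaryDualPairDoubledLineStabiliser`,
★ `UnitaryGroupDoubledSiegelBruhat`).  KERNEL only: proved theorems, no definition, no named fact, no `sorry`.  Setting: a quadratic extension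
`E/F` of number fields with conjugation `c`, `δ ∈ E` with `c δ = −δ ≠ 0`, a hermitian LINE `T_W ∈ M₁(F)` (`IsUnit (det T_W)`), and the rational
doubled rank-one unitary group `U := U(T_W ⊕ᶠ −T_W)(F) = rational F E c (1+1) ((finSum 1 1 T_W (−T_W)).map (algebraMap F E)) ≅ U(1,1)(F)`; its
rational Siegel parabolic `P_Δ(F)` = the stabiliser of the diagonal line `W^Δ` = the "row-sum" matrices
(★ `isSiegelReindex_finSumFinEquiv_iff_rowSum`).

* `rowSum_mul` — row-sum matrices are closed under products.
* `monoidHom_apply_eq_one_of_forall_rowSum` — **a homomorphism `χ : U →* A`, `A` commutative, with `χ = 1` on `P_Δ(F)` is trivial.**  Proof: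
  `χ(g q g⁻¹) = χ(q) = 1` for `q ∈ P_Δ(F)` (abelian target); the explicit `q = 1 + (δ/2)·ν ∈ P_Δ(F)` (`ν² = 0`) and `g₁ = diag(1, −1) ∈ U` have
  `g₁ q g₁⁻¹ ∉ P_Δ(F)` (as `δ ≠ 0`); by the Bruhat decomposition `U = P_Δ(F) ⊔ P_Δ(F)·W₁·P_Δ(F)` (★ `DoubledUnitary.exists_bruhat_reindex`) every
  non-Siegel element is `P_Δ(F)`-bi-equivalent to the single cell representative `W₁`, hence `χ = χ(W₁) = χ(g₁ q g₁⁻¹) = 1` on the big cell.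
  (Used by the sequel ★ `UnitaryDualPairDoubledDiagonalThetaInvariance`: the twist character of `S̃ r_F(γ_w) S̃⁻¹` against `r_F(γ_w)` is trivial.)

Written for the Hodge-CM cell `pub/hodgecm-mathlib`, floor 0, crux H413 (stmt-HodgeConjecture-24833), E-2 child line `F0_E2SiegelWeilWeilRange`, row
(INV)-theta of F0P4-p07's assembly sheet `SW2c-BOUND-ASSEMBLY`; seat F0P4-p02 (g3), 2026-08-31.  HC_CM is proved only modulo the printed citations
until rung 0 closes; nothing here bears on a summit statement.

## References
* [MoeglinVignerasWaldspurger1987] C. Mœglin, M.-F. Vignéras, J.-L. Waldspurger, *Correspondances de Howe sur un corps p-adique*, LNM 1291 (1987),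
  Chap. 2 II.1 (Bruhat decomposition of `U(W ⊕ W⁻)` relative to `P_Δ`).
* [GelbartPiatetskishapiroRallis1987] S. Gelbart, I. Piatetski-Shapiro, S. Rallis, LNM 1254 (1987), Part A §2 pp. 7–9 (`P_Δ`, the doubled group).
-/

set_option autoImplicit false

noncomputable section

open scoped Matrix
open NumberField

namespace Literature.NumberTheory.Automorphic

namespace UnitaryGroup

/-! ## §1 `U(1,1)(F)`: a homomorphism to a commutative group that kills the Siegel parabolic `P_Δ(F)` is trivial -/

section RowSum

variable {K : Type*} [CommRing K]

/-- products of "row-sum" (`P_Δ`, ★ `isSiegelReindex_finSumFinEquiv_iff_rowSum`) `2 × 2` matrices are row-sum (`P_Δ` is a subgroup).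
[cite: GelbartPiatetskishapiroRallis1987, Part A §2 pp. 7–9] -/
theorem rowSum_mul (p q : GL (Fin (1 + 1)) K)
    (hp : (p : Matrix (Fin (1 + 1)) (Fin (1 + 1)) K) 0 0 + (p : Matrix (Fin (1 + 1)) (Fin (1 + 1)) K) 0 1 =
      (p : Matrix (Fin (1 + 1)) (Fin (1 + 1)) K) 1 0 + (p : Matrix (Fin (1 + 1)) (Fin (1 + 1)) K) 1 1)
    (hq : (q : Matrix (Fin (1 + 1)) (Fin (1 + 1)) K) 0 0 + (q : Matrix (Fin (1 + 1)) (Fin (1 + 1)) K) 0 1 =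
      (q : Matrix (Fin (1 + 1)) (Fin (1 + 1)) K) 1 0 + (q : Matrix (Fin (1 + 1)) (Fin (1 + 1)) K) 1 1) :
    ((p * q : GL (Fin (1 + 1)) K) : Matrix (Fin (1 + 1)) (Fin (1 + 1)) K) 0 0 + ((p * q : GL (Fin (1 + 1)) K) : Matrix (Fin (1 + 1)) (Fin (1 + 1)) K) 0 1 =
      ((p * q : GL (Fin (1 + 1)) K) : Matrix (Fin (1 + 1)) (Fin (1 + 1)) K) 1 0 + ((p * q : GL (Fin (1 + 1)) K) : Matrix (Fin (1 + 1)) (Fin (1 + 1)) K) 1 1 := by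
  have sum2 : ∀ f : Fin (1 + 1) → K, ∑ j, f j = f 0 + f 1 := fun f => Fin.sum_univ_two f
  simp only [Units.val_mul, Matrix.mul_apply, sum2]
  linear_combination ((q : Matrix (Fin (1 + 1)) (Fin (1 + 1)) K) 0 0 + (q : Matrix (Fin (1 + 1)) (Fin (1 + 1)) K) 0 1) * hp -
    ((p : Matrix (Fin (1 + 1)) (Fin (1 + 1)) K) 0 1 - (p : Matrix (Fin (1 + 1)) (Fin (1 + 1)) K) 1 1) * hq

end RowSum

section RankOneAlgebra

variable (F E : Type) [Field F] [NumberField F] [Field E] [NumberField E] [Algebra F E] [Algebra.IsQuadraticExtension F E]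
  (c : E ≃ₐ[F] E) {δ : E} (hcδ : c δ = -δ) (hδ : δ ≠ 0)
  {TW : Matrix (Fin 1) (Fin 1) F} {TW2 : Matrix (Fin (1 + 1)) (Fin (1 + 1)) F}
  (hW : TW.IsSymm) (hWd : IsUnit TW.det) (hTW2 : TW2 = finSum 1 1 TW (-TW))

include hcδ hδ hW hWd hTW2 in
/-- **A HOMOMORPHISM `χ : U(T_W ⊕ᶠ −T_W)(F) →* A` TO A COMMUTATIVE GROUP THAT KILLS THE RATIONAL SIEGEL PARABOLIC `P_Δ(F)` IS TRIVIAL.**  Here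
`U(T_W ⊕ᶠ −T_W)(F) ≅ U(1,1)(F)` is the rational doubled rank-one unitary group and `P_Δ(F)`, the stabiliser of the diagonal line `W^Δ`, is the
subgroup of "row-sum" matrices (★ `isSiegelReindex_finSumFinEquiv_iff_rowSum`).  Proof: `χ(g q g⁻¹) = χ(q) = 1` for `q ∈ P_Δ(F)` (abelian
target); the explicit `q = 1 + (δ/2)ν ∈ P_Δ(F)` and `g₁ = diag(1,−1) ∈ U(F)` have `g₁ q g₁⁻¹ ∉ P_Δ(F)`; by the Bruhat decomposition
`U(F) = P_Δ(F) ⊔ P_Δ(F)·W₁·P_Δ(F)` (★ `DoubledUnitary.exists_bruhat_reindex`) every non-Siegel element is `p₁ (g₁ q g₁⁻¹)' p₂`-equivalent to the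
single cell representative `W₁`, so `χ = χ(W₁) = χ(g₁ q g₁⁻¹) = 1` on the big cell as well.
[cite: MoeglinVignerasWaldspurger1987, Chap. 2 II.1] [cite: GelbartPiatetskishapiroRallis1987, Part A §2 pp. 7–9] -/
theorem monoidHom_apply_eq_one_of_forall_rowSum {A : Type*} [CommGroup A]
    (χ : rational F E c (1 + 1) (TW2.map (algebraMap F E)) →* A)
    (hχP : ∀ w' : rational F E c (1 + 1) (TW2.map (algebraMap F E)),
      ((w' : GL (Fin (1 + 1)) E) : Matrix (Fin (1 + 1)) (Fin (1 + 1)) E) 0 0 + ((w' : GL (Fin (1 + 1)) E) : Matrix (Fin (1 + 1)) (Fin (1 + 1)) E) 0 1 =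
        ((w' : GL (Fin (1 + 1)) E) : Matrix (Fin (1 + 1)) (Fin (1 + 1)) E) 1 0 + ((w' : GL (Fin (1 + 1)) E) : Matrix (Fin (1 + 1)) (Fin (1 + 1)) E) 1 1 →
      χ w' = 1)
    (u : rational F E c (1 + 1) (TW2.map (algebraMap F E))) : χ u = 1 := by
  have hχconj : ∀ g' q' : rational F E c (1 + 1) (TW2.map (algebraMap F E)), χ (g' * q' * g'⁻¹) = χ q' := fun g' q' => by
    rw [χ.map_mul, χ.map_mul, χ.map_inv, mul_inv_cancel_comm]
  -- data for ★ `exists_bruhat_reindex` in the diagonal model `S ⊕ (−S)`, `S = T_W ⊗ 1`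
  have h2E : (2 : E) ≠ 0 := two_ne_zero
  have hc1 : c ≠ 1 := by
    intro h1
    apply hδ
    have h0 : δ = -δ := by simpa [h1] using hcδ
    exact self_eq_neg.1 h0
  have hcc : ∀ x : E, c (c x) = x := fun x => by
    have := congrArg (fun f : E ≃ₐ[F] E => f x) (algEquiv_mul_self_eq_one F hc1)
    simpa using this
  have hSσ : (TW.map (algebraMap F E)).map (c : E →+* E) = TW.map (algebraMap F E) := by
    ext i j; simp
  have hSs : (TW.map (algebraMap F E))ᵀ = TW.map (algebraMap F E) := by
    ext i j; simp only [Matrix.transpose_apply, Matrix.map_apply, hW.apply i j]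
  have hSu : IsUnit (TW.map (algebraMap F E)).det := by
    rw [show TW.map (algebraMap F E) = (algebraMap F E).mapMatrix TW from rfl, ← RingHom.map_det]
    exact hWd.map _
  have hSu2 : IsUnit (TW.map (algebraMap F E) + TW.map (algebraMap F E)).det := by
    rw [← two_smul E (TW.map (algebraMap F E)), Matrix.det_smul]
    exact ((isUnit_iff_ne_zero.2 h2E).pow _).mul hSu
  have hdiag1 : Matrix.diagonal (fun _ : Fin 1 => (1 : E)) * Matrix.diagonal (fun _ : Fin 1 => (1 : E)) = Matrix.diagonal fun _ : Fin 1 => (1 : E) := by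
    rw [Matrix.diagonal_mul_diagonal]; simp
  have hJ : TW2.map (algebraMap F E) = Matrix.reindex finSumFinEquiv finSumFinEquiv (DoubledUnitary.diagForm (TW.map (algebraMap F E))) := by
    rw [hTW2, finSum_map, Matrix.map_neg _ (map_neg (algebraMap F E))]; rfl
  have hmemU : ∀ w' : rational F E c (1 + 1) (TW2.map (algebraMap F E)),
      (w' : GL (Fin (1 + 1)) E) ∈ unitaryGroupOfForm (c : E →+* E)
        (Matrix.reindex (finSumFinEquiv : Fin 1 ⊕ Fin 1 ≃ Fin (1 + 1)) finSumFinEquiv (DoubledUnitary.diagForm (TW.map (algebraMap F E)))) :=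
    fun w' => hJ ▸ w'.2
  have hmemU' : ∀ g' : GL (Fin (1 + 1)) E, g' ∈ unitaryGroupOfForm (c : E →+* E)
        (Matrix.reindex (finSumFinEquiv : Fin 1 ⊕ Fin 1 ≃ Fin (1 + 1)) finSumFinEquiv (DoubledUnitary.diagForm (TW.map (algebraMap F E)))) →
      g' ∈ rational F E c (1 + 1) (TW2.map (algebraMap F E)) := fun g' hg' => by
    show g' ∈ unitaryGroupOfForm (c : E →+* E) (TW2.map (algebraMap F E))
    rw [hJ]; exact hg'
  -- `u = p₁ z p₂` with Siegel `p₁, p₂ ∈ U(F)` ⇒ `χ u = χ z`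
  have hmid : ∀ (u z : rational F E c (1 + 1) (TW2.map (algebraMap F E))) (p₁ p₂ : GL (Fin (1 + 1)) E)
      (hp₁ : p₁ ∈ rational F E c (1 + 1) (TW2.map (algebraMap F E))) (hp₂ : p₂ ∈ rational F E c (1 + 1) (TW2.map (algebraMap F E))),
      (p₁ : Matrix (Fin (1 + 1)) (Fin (1 + 1)) E) 0 0 + (p₁ : Matrix (Fin (1 + 1)) (Fin (1 + 1)) E) 0 1 =
        (p₁ : Matrix (Fin (1 + 1)) (Fin (1 + 1)) E) 1 0 + (p₁ : Matrix (Fin (1 + 1)) (Fin (1 + 1)) E) 1 1 →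
      (p₂ : Matrix (Fin (1 + 1)) (Fin (1 + 1)) E) 0 0 + (p₂ : Matrix (Fin (1 + 1)) (Fin (1 + 1)) E) 0 1 =
        (p₂ : Matrix (Fin (1 + 1)) (Fin (1 + 1)) E) 1 0 + (p₂ : Matrix (Fin (1 + 1)) (Fin (1 + 1)) E) 1 1 →
      (u : GL (Fin (1 + 1)) E) = p₁ * (z : GL (Fin (1 + 1)) E) * p₂ → χ u = χ z := by
    intro u z p₁ p₂ hp₁ hp₂ hr₁ hr₂ hu
    have hu' : u = ⟨p₁, hp₁⟩ * z * ⟨p₂, hp₂⟩ := Subtype.ext hu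
    rw [hu', χ.map_mul, χ.map_mul, hχP ⟨p₁, hp₁⟩ hr₁, hχP ⟨p₂, hp₂⟩ hr₂, one_mul, mul_one]
  -- the Bruhat decomposition: every `u ∈ U(F)` is Siegel, or its cell representative is THE Weyl element `W₁`
  have hbru : ∀ u : rational F E c (1 + 1) (TW2.map (algebraMap F E)),
      (((u : GL (Fin (1 + 1)) E) : Matrix (Fin (1 + 1)) (Fin (1 + 1)) E) 0 0 + ((u : GL (Fin (1 + 1)) E) : Matrix (Fin (1 + 1)) (Fin (1 + 1)) E) 0 1 =
        ((u : GL (Fin (1 + 1)) E) : Matrix (Fin (1 + 1)) (Fin (1 + 1)) E) 1 0 + ((u : GL (Fin (1 + 1)) E) : Matrix (Fin (1 + 1)) (Fin (1 + 1)) E) 1 1) ∨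
      ∃ z : rational F E c (1 + 1) (TW2.map (algebraMap F E)),
        (z : GL (Fin (1 + 1)) E) = Units.mapEquiv (Matrix.reindexRingEquiv E (finSumFinEquiv : Fin 1 ⊕ Fin 1 ≃ Fin (1 + 1))).toMulEquiv
          (DoubledUnitary.cayley E (Fin 1) h2E * (DoubledUnitary.rescale (TW.map (algebraMap F E) + TW.map (algebraMap F E)) hSu2 *
            DoubledUnitary.partialWeyl (Matrix.diagonal fun _ : Fin 1 => (1 : E)) hdiag1 *
            (DoubledUnitary.rescale (TW.map (algebraMap F E) + TW.map (algebraMap F E)) hSu2)⁻¹) * (DoubledUnitary.cayley E (Fin 1) h2E)⁻¹) ∧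
        χ u = χ z := by
    intro u
    obtain ⟨χ01, hχ01, hτu, p₁, p₂, hp₁, hp₂, hS₁, hS₂, hfac⟩ :=
      DoubledUnitary.exists_bruhat_reindex (σ := (c : E →+* E)) (e := (finSumFinEquiv : Fin 1 ⊕ Fin 1 ≃ Fin (1 + 1))) h2E hcc hSσ hSs hSu (hmemU u)
    have hr₁ := (isSiegelReindex_finSumFinEquiv_iff_rowSum p₁).1 hS₁
    have hr₂ := (isSiegelReindex_finSumFinEquiv_iff_rowSum p₂).1 hS₂
    have hp₁' := hmemU' p₁ hp₁
    have hp₂' := hmemU' p₂ hp₂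
    have hWmem : p₁⁻¹ * (u : GL (Fin (1 + 1)) E) * p₂⁻¹ ∈ rational F E c (1 + 1) (TW2.map (algebraMap F E)) :=
      mul_mem (mul_mem (inv_mem hp₁') u.2) (inv_mem hp₂')
    have key : ∀ T : GL (Fin (1 + 1)) E, (u : GL (Fin (1 + 1)) E) = p₁ * T * p₂ → p₁⁻¹ * (u : GL (Fin (1 + 1)) E) * p₂⁻¹ = T :=
      fun T hT => by rw [hT]; group
    have huz : (u : GL (Fin (1 + 1)) E) = p₁ * (p₁⁻¹ * (u : GL (Fin (1 + 1)) E) * p₂⁻¹) * p₂ := by group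
    rcases hχ01 0 with h0 | h1
    · have hχf : χ01 = fun _ => 0 := funext fun i => by rw [Subsingleton.elim i 0]; exact h0
      subst hχf
      left
      have hd0 : (Matrix.diagonal fun _ : Fin 1 => (0 : E)) = 0 := by ext i j; simp
      have hpw : ∀ hE, DoubledUnitary.partialWeyl (Matrix.diagonal fun _ : Fin 1 => (0 : E)) hE = 1 := fun hE => Units.ext (by
        change Matrix.fromBlocks (1 - Matrix.diagonal fun _ : Fin 1 => (0 : E)) (Matrix.diagonal fun _ => 0) (Matrix.diagonal fun _ => 0)
          (1 - Matrix.diagonal fun _ => 0) = 1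
        rw [hd0, sub_zero, Matrix.fromBlocks_one])
      rw [hpw, mul_one, mul_inv_cancel, mul_one, mul_inv_cancel, map_one, mul_one] at hfac
      rw [hfac]
      exact rowSum_mul p₁ p₂ hr₁ hr₂
    · have hχf : χ01 = fun _ => 1 := funext fun i => by rw [Subsingleton.elim i 0]; exact h1
      subst hχf
      right
      exact ⟨⟨_, hWmem⟩, key _ hfac, hmid u ⟨_, hWmem⟩ p₁ p₂ hp₁' hp₂' hr₁ hr₂ huz⟩
  -- the explicit conjugate off `P_Δ(F)`: `q = 1 + (δ/2)·N` (`N² = 0`, Siegel), `g₁ = diag(1, −1)`, `g₁ q g₁⁻¹` not Siegel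
  have sum2 : ∀ f : Fin (1 + 1) → E, ∑ j, f j = f 0 + f 1 := fun f => Fin.sum_univ_two f
  have hs0 : ((finSumFinEquiv : Fin 1 ⊕ Fin 1 ≃ Fin (1 + 1)).symm 0 : Fin 1 ⊕ Fin 1) = Sum.inl 0 := by decide
  have hs1 : ((finSumFinEquiv : Fin 1 ⊕ Fin 1 ≃ Fin (1 + 1)).symm 1 : Fin 1 ⊕ Fin 1) = Sum.inr 0 := by decide
  have hJm : TW2.map (algebraMap F E) = !![algebraMap F E (TW 0 0), 0; 0, -algebraMap F E (TW 0 0)] := by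
    rw [hJ]
    ext i j
    fin_cases i <;> fin_cases j <;>
      simp [DoubledUnitary.diagForm, Matrix.reindex_apply, hs0, hs1, Matrix.fromBlocks_apply₁₁, Matrix.fromBlocks_apply₁₂,
        Matrix.fromBlocks_apply₂₁, Matrix.fromBlocks_apply₂₂]
  have hcδ2 : c (δ / 2) = -(δ / 2) := by rw [map_div₀, hcδ, map_ofNat, neg_div]
  have hqdet : (!![1 + δ / 2, -(δ / 2); δ / 2, 1 - δ / 2] : Matrix (Fin (1 + 1)) (Fin (1 + 1)) E).det ≠ 0 := by
    rw [Matrix.det_fin_two_of]; ring_nf; exact one_ne_zero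
  have hg1det : (!![1, 0; 0, -1] : Matrix (Fin (1 + 1)) (Fin (1 + 1)) E).det ≠ 0 := by
    rw [Matrix.det_fin_two_of]; norm_num
  have hqmem : Matrix.GeneralLinearGroup.mkOfDetNeZero _ hqdet ∈ rational F E c (1 + 1) (TW2.map (algebraMap F E)) := by
    show ((!![1 + δ / 2, -(δ / 2); δ / 2, 1 - δ / 2] : Matrix (Fin (1 + 1)) (Fin (1 + 1)) E).map (c : E →+* E))ᵀ *
        TW2.map (algebraMap F E) * !![1 + δ / 2, -(δ / 2); δ / 2, 1 - δ / 2] = TW2.map (algebraMap F E)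
    rw [hJm]
    ext i j
    fin_cases i <;> fin_cases j <;> simp [Matrix.mul_apply, sum2, hcδ2] <;> ring
  have hg1mem : Matrix.GeneralLinearGroup.mkOfDetNeZero _ hg1det ∈ rational F E c (1 + 1) (TW2.map (algebraMap F E)) := by
    show ((!![1, 0; 0, -1] : Matrix (Fin (1 + 1)) (Fin (1 + 1)) E).map (c : E →+* E))ᵀ * TW2.map (algebraMap F E) * !![1, 0; 0, -1] =
      TW2.map (algebraMap F E)
    rw [hJm]
    ext i j
    fin_cases i <;> fin_cases j <;> simp [Matrix.mul_apply, sum2]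
  have hg1sq : Matrix.GeneralLinearGroup.mkOfDetNeZero _ hg1det * Matrix.GeneralLinearGroup.mkOfDetNeZero _ hg1det = 1 := by
    refine Units.ext ?_
    show (!![1, 0; 0, -1] : Matrix (Fin (1 + 1)) (Fin (1 + 1)) E) * !![1, 0; 0, -1] = 1
    ext i j
    fin_cases i <;> fin_cases j <;> simp [Matrix.mul_apply, sum2]
  have hexq : ∃ qU : rational F E c (1 + 1) (TW2.map (algebraMap F E)),
      ((qU : GL (Fin (1 + 1)) E) : Matrix (Fin (1 + 1)) (Fin (1 + 1)) E) = !![1 + δ / 2, -(δ / 2); δ / 2, 1 - δ / 2] :=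
    ⟨⟨_, hqmem⟩, rfl⟩
  obtain ⟨qU, hqU⟩ := hexq
  have hexg : ∃ g1U : rational F E c (1 + 1) (TW2.map (algebraMap F E)),
      (g1U : GL (Fin (1 + 1)) E) = Matrix.GeneralLinearGroup.mkOfDetNeZero _ hg1det :=
    ⟨⟨_, hg1mem⟩, rfl⟩
  obtain ⟨g1U, hg1U'⟩ := hexg
  have hg1U := congrArg Units.val hg1U'
  rewrite [Matrix.GeneralLinearGroup.val_mkOfDetNeZero] at hg1U  -- `rewrite`, not `rw`: no `rfl` try on the main goal
  have hg1inv : g1U⁻¹ = g1U :=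
    Subtype.ext (by rw [Subgroup.coe_inv, hg1U']; exact inv_eq_of_mul_eq_one_right hg1sq)
  have hq_row := hχP qU (by rw [hqU]; simp)
  have hg0 : ¬ ((((g1U * qU * g1U⁻¹ : rational F E c (1 + 1) (TW2.map (algebraMap F E))) : GL (Fin (1 + 1)) E) :
        Matrix (Fin (1 + 1)) (Fin (1 + 1)) E) 0 0 +
      (((g1U * qU * g1U⁻¹ : rational F E c (1 + 1) (TW2.map (algebraMap F E))) : GL (Fin (1 + 1)) E) :
        Matrix (Fin (1 + 1)) (Fin (1 + 1)) E) 0 1 =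
      (((g1U * qU * g1U⁻¹ : rational F E c (1 + 1) (TW2.map (algebraMap F E))) : GL (Fin (1 + 1)) E) :
        Matrix (Fin (1 + 1)) (Fin (1 + 1)) E) 1 0 +
      (((g1U * qU * g1U⁻¹ : rational F E c (1 + 1) (TW2.map (algebraMap F E))) : GL (Fin (1 + 1)) E) :
        Matrix (Fin (1 + 1)) (Fin (1 + 1)) E) 1 1) := by
    rw [hg1inv]
    intro hrow
    have hrow' : (1 + δ / 2) + δ / 2 = -(δ / 2) + (1 - δ / 2) := by
      simp only [Subgroup.coe_mul, Units.val_mul, hqU, hg1U] at hrow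
      simpa [Matrix.mul_apply, sum2] using hrow
    have h2δ : (2 : E) * δ = 0 := by linear_combination hrow'
    exact hδ ((mul_eq_zero.1 h2δ).resolve_left h2E)
  have hχg0 : χ (g1U * qU * g1U⁻¹) = 1 := (hχconj g1U qU).trans hq_row
  -- `χ = 1`
  have hχ1 : ∀ u : rational F E c (1 + 1) (TW2.map (algebraMap F E)), χ u = 1 := by
    intro u
    rcases hbru u with hrow | ⟨z, hz, huz⟩
    · exact hχP u hrow
    rcases hbru (g1U * qU * g1U⁻¹) with hrow0 | ⟨z', hz', hg0z'⟩
    · exact absurd hrow0 hg0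
    rw [huz, Subtype.ext (hz.trans hz'.symm), ← hg0z']
    exact hχg0
  exact hχ1 u

end RankOneAlgebra

end UnitaryGroup

end Literature.NumberTheory.Automorphic
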